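import Summits.QuantumFields.BalabanUV.T4Continuum.Support.BlockAverageLoopFlux
import Literature.MathematicalPhysics.QuantumFieldTheory.Balaban1983to89.B7Eq42NotEuclideanSymmetric
import HarnessLib

/-!
# YM-DAG node N16 (NE3), the located averaging pin (42) ↔ (0.4) — sequel to (α)∕(α′): THE PERMUTATION DEFECT OF
# BAŁABAN'S BLOCK AVERAGE (42), QUANTIFIED (exact identity · constant flux ⇒ NO defect · Lipschitz flux ⇒ defect `O(L³δ)`),
# at the linearised level of [B7] (47)–(48) (part 1 of 2; part 2 = `…PermutationDefectAbelian`, the abelian average itself)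

Cell `pub-ymgap`, width seat `pub-ymgap-dag-n16-w3` (director-ym №197 ∕ HUMAN RULING D-0149), generation 2 (harness re-seat of g0);
own-lane product of the W1b axis «the located averaging pin (42) ↔ (0.4)» (plan g77 `W-SEAT-START-LIST.md` §2 n16 item 3).
`--kind proof --supports stmt-QuantumFields-20544 --as helper` (K3⁷ `SpineGivenEndpointR13SepCoPH`; count-neutral).  `bears_on: R4∕N16`.

THE POINT.  Generation 0 certified [Balaban1987RG1] p. 252's sentence «(42) is not symmetric with respect to lattice Euclidean
transformations» for the tree's concrete average `B7Prop1Explicit.bavg` (`Literature/…/B7Eq42NotEuclideanSymmetric(General)`: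
`¬ PermEquivariantAt (bavg L) σ`, witnessed by a SINGLE-DEFECT `U(1)` field — a field whose flux is a lattice delta).  This file says
HOW LARGE the relabelling defect of (42) is and WHERE IT VANISHES, at the level of the first-order exponent `X̂_c` ∕ the linear contour
average `T_c = X̂_c + A(Γ_c)` of [Balaban1985Averaging] (47)–(48) (tree `B7Prop1Explicit.Xhat ∕ Tside`; coefficients in any
normed ring — the LINEARISED content of (42), exact for abelian fields by `AbelianBlockAverage.bavg_expUnit`):
 * §2 **EXACT IDENTITY** (any normed ring): `X̂[r_σA](q, κ) − X̂[A](r_σq, σκ) = Σ_r L^{−d} • [D_v(q′) − D_v(q′ + L e_{σκ})]`,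
   `D_v(p) = A(permWord σ v from p) − A(treeWord v from p)` = the circulation of `A` around the CLOSED broken loop «σ-ordered tree
   contour of [Balaban1987RG1] p. 252, then the standard tree contour of [B7] p. 24 backwards» (`Xhat_permCfg_sub`,
   `Xhat_permCfg_sub_eq_loops`, `Tside_permCfg_sub`): the relabelling defect is the STEP-`L` DIFFERENCE QUOTIENT, in the bond
   direction, of a block mean of closed-loop circulations — a pure lattice-derivative term; hence NO defect whenever those
   circulations are `L e_{σκ}`-periodic (`Xhat_permCfg_eq_of_periodic`);
 * §3 **CONSTANT FLUX ⇒ NO DEFECT**: if the plaquette circulations `A(∂p)` in the planes `(m, σκ)` do not depend on the base point,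
   `X̂[r_σA](q,κ) = X̂[A](r_σq, σκ)` (`Xhat_permCfg_of_const_flux`; the tree's constant-flux value `(L(L−1)∕2)•Σ_m f_m`,
   `BlockAverageLoopFlux.Xhat_of_const_flux`, on both sides, reindexed `m ↦ σm`); **LIPSCHITZ FLUX ⇒ SMALL DEFECT**: circulations
   `δ`-Lipschitz in the base point (in `|·|₁`, range `(d+2)L`) give `‖X̂-defect‖ ≤ d(d+2)·L³·δ` (`norm_Xhat_permCfg_sub_le`,
   `BlockAverageLoopFlux.norm_Xhat_sub_const_flux_le` on both sides — the constant-flux main terms agree); loop sums are controlled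
   by a FLUX bound, `‖A(Γ_{c,x} ∪ −Γ_c)‖ ≤ d·L²·φ` (`norm_loop_le_of_flux`, the tree's loop-flux formula), so the ball of the
   logarithm is reached by small curvature — the bond field may grow linearly;
 * §4 **NON-VACUITY of the constant-flux hypothesis**: for every antisymmetric family `f` of plaquette values with zero diagonal the
   linear potential `A(x,κ) = Σ_{ν<κ} x_ν • f ν κ` has constant flux `f` (`linPot_diff`, `exists_const_flux`) — lattice constant
   curvature, NOT a pure gauge (cell rule A6).
 * The companion file `BalabanUVNodesN16Eq42PermutationDefectAbelian` exponentiates: in a COMMUTATIVE coefficient algebra (42) itself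
   (`AbelianBlockAverage.bavg_expUnit`: `V̄_c = exp T_c`) IS relabelling-equivariant at every constant-flux field, with the relative
   Lipschitz-flux defect bound `‖V̄[r_σW](c) − (r_σV̄[W])(c)‖ ≤ ‖(r_σV̄[W])(c)‖·(e^{d(d+2)L³δ} − 1)`.

READING FOR N16 (honest; nothing below is a theorem of this file about minimisers).  On a level-`j` configuration of [B11]-Thm-1 TYPE
regularity — flux `≤ b η²`, flux Lipschitz constant `δ = c η³`, `η = L^{−j}` (the tree's `RegularSup` letters) — the Euclidean
asymmetry of (42) per coarse bond is `O(d²L³·c·η³)`, while (42) itself deviates from the straight transporter by its first-order term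
`X̂ = O(dL²·b·η²)`: relative size `O(L c η ∕ b) → 0`.  The asymmetry that the located pin records (p584628 `Transfer42to04 ∕
Transfer04to42`, displayed hypotheses; (α)∕(α′)) is a LATTICE ARTEFACT invisible at the continuum scale on regular fields, consistent
with [Balaban1987RG1] p. 254 «both definitions are equally good for our purposes».  This quantifies what the pin can cost at first
order; it does NOT prove the transfer (the (42)- and (0.4)-constrained variational problems have different constraint manifolds),
and the non-abelian (42) adds [B7] Prop. 1's `O(a²)` terms, not treated here.

HONEST FRAMING.  [folklore] lattice bookkeeping over landed modules BY NAME (`B7Prop1Explicit`, `BlockAverageLoopFlux`,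
lit-balaban's `B12Average012Permutation` ∕ `B12ContourAverage253`); 0 `def`, 0 `sorry`; no printed sentence is
a hypothesis; nothing of [Balaban1985Averaging] ∕ [Balaban1987RG1] is asserted beyond what the tree proves; no minimiser, no
variational problem, no estimate of Bałaban's; `stub_h7` NOT closed; N16 ∕ NE3 NOT discharged; count-neutral (typed 28∕28 · discharged
5∕27 unmoved).  One finite four-torus programme at fixed `ε`: NOT ℝ⁴, NOT infinite volume, NOT OS, NOT a mass gap — the Yang–Mills mass
gap (Clay) is NOT proved by any of this; R4 closes the conditional finite-𝕋⁴ rung `BalabanLadder.UV` only.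
Context: T. Bałaban, Commun. Math. Phys. **98** (1985) 17–51 [Balaban1985Averaging] (42) p. 23, (47)–(48) p. 25; **109** (1987) 249–301
[Balaban1987RG1] pp. 252–254, (2.17) p. 269.
-/

set_option autoImplicit false

open scoped BigOperators
open NormedSpace Finset

namespace Summit.QuantumFields.YangMills.BalabanUVNodes.N16Eq42PermutationDefect

open Literature.MathematicalPhysics.QuantumFieldTheory.Balaban1983to89
open B7Prop1Explicit
open B12Average012Permutation (permSite permCfg permLetter permSite_apply permCfg_apply vec_permLetter permSite_add
  permSite_sub permSite_e permSite_smul permSite_neg map_seg map_tw permLetter_mk)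
open B12ContourAverage253 (permWord disp_permWord)
open B8Lemma1NonAbelian (tw treeWord_eq_tw)
open Summit.QuantumFields.BalabanUV.T4Continuum.BlockAverageLoopFlux (Xhat_of_const_flux norm_Xhat_sub_const_flux_le)

noncomputable section

variable {d : ℕ}

/-! ## §1 Relabelling the axes in the linear (abelian) word calculus -/

/-- The relabelled letter of a reversed letter is the reversed relabelled letter. [folklore] -/
theorem permLetter_rev (σ : Equiv.Perm (Fin d)) (l : Letter d) : permLetter σ l.rev = (permLetter σ l).rev := by
  obtain ⟨μ, b⟩ := l
  rfl

/-- Relabelling commutes with word reversal. [folklore] -/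
theorem map_permLetter_revWord (σ : Equiv.Perm (Fin d)) (w : List (Letter d)) :
    (revWord w).map (permLetter σ) = revWord (w.map (permLetter σ)) := by
  simp only [revWord, List.map_reverse, List.map_map, Function.comp_def, permLetter_rev]

/-- The tree contour `Γ_{y,y+v}` (axes `d−1, …, 0`) relabelled by `σ` is the `σ`-ORDERED broken line `permWord σ` to the relabelled
end point (lit-balaban's `permWord`, [Balaban1987RG1] p. 252's permuted contours). [cite: Balaban1987RG1, p.252] -/
theorem map_permLetter_treeWord (σ : Equiv.Perm (Fin d)) (v : Site d) :
    (treeWord v).map (permLetter σ) = permWord σ (permSite σ v) := by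
  rw [treeWord_eq_tw, map_tw]
  rfl

/-- The contour `Γ_{c,x}` of (42) relabelled: `σ`-ordered tree, straight segment in the relabelled direction, reversed
`σ`-ordered tree. [cite: Balaban1985Averaging, (14) p.19] -/
theorem map_permLetter_gammaWord (σ : Equiv.Perm (Fin d)) (L : ℕ) (κ : Fin d) (v : Site d) :
    (gammaWord L κ v).map (permLetter σ)
      = permWord σ (permSite σ v) ++ seg (σ κ) L ++ revWord (permWord σ (permSite σ v)) := by
  simp only [gammaWord, List.map_append, map_seg, map_permLetter_revWord, map_permLetter_treeWord]

/-- The `ℓ¹` length is invariant under relabelling the axes. [folklore] -/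
theorem l1_permSite (σ : Equiv.Perm (Fin d)) (v : Site d) : l1 (permSite σ v) = l1 v := by
  unfold l1
  simp only [permSite_apply]
  exact Equiv.sum_comp σ.symm (fun κ => (v κ).natAbs)

/-- The corner block is carried to the corner block: `r_σ` of the offset `boxVec L r` is the offset of the reindexed `r ∘ σ⁻¹`. [folklore] -/
theorem permSite_boxVec (σ : Equiv.Perm (Fin d)) (L : ℕ) (r : Fin d → Fin L) :
    permSite σ (boxVec L r) = boxVec L (fun ν => r (σ.symm ν)) := rfl

section Linear

variable {𝔸 : Type*} [NormedRing 𝔸]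

/-- One letter of the abelian path functional of a relabelled bond field. [folklore] -/
theorem stepA_permCfg (σ : Equiv.Perm (Fin d)) (A : Site d → Fin d → 𝔸) (x : Site d) (l : Letter d) :
    stepA (permCfg σ A) x l = stepA A (permSite σ x) (permLetter σ l) := by
  obtain ⟨μ, b⟩ := l
  cases b <;> simp [stepA, Letter.vec, permLetter]

/-- **THE ABELIAN PATH FUNCTIONAL IS COVARIANT UNDER AXIS PERMUTATIONS**: `(r_σA)(Γ from x) = A(r_σΓ from r_σx)` (the additive
twin of lit-balaban's `hol_permCfg`). [cite: Balaban1987RG1, (2.17) p.269] -/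
theorem asum_permCfg (σ : Equiv.Perm (Fin d)) (A : Site d → Fin d → 𝔸) :
    ∀ (x : Site d) (w : List (Letter d)), asum (permCfg σ A) x w = asum A (permSite σ x) (w.map (permLetter σ))
  | x, [] => by simp
  | x, l :: w => by
    rw [List.map_cons, asum_cons, asum_cons, stepA_permCfg, asum_permCfg σ A (x + l.vec) w, vec_permLetter, permSite_add]

/-- Straight segments are relabelled to straight segments. [folklore] -/
theorem asum_seg_permCfg (σ : Equiv.Perm (Fin d)) (A : Site d → Fin d → 𝔸) (x : Site d) (κ : Fin d) (n : ℤ) :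
    asum (permCfg σ A) x (seg κ n) = asum A (permSite σ x) (seg (σ κ) n) := by
  rw [asum_permCfg, map_seg]

/-- Plaquette circulations are relabelled to plaquette circulations: `(r_σA)(∂p_{m k} at p) = A(∂p_{σm σk} at r_σ p)`. [folklore] -/
theorem asum_plaqWord_permCfg (σ : Equiv.Perm (Fin d)) (A : Site d → Fin d → 𝔸) (p : Site d) (m k : Fin d) :
    asum (permCfg σ A) p (plaqWord m k) = asum A (permSite σ p) (plaqWord (σ m) (σ k)) := by
  rw [asum_permCfg]
  simp [plaqWord, permLetter]

/-! ## §2 The exact defect identity -/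

/-- The difference of the (42)-type contour sums built on two broken lines `w₁`, `w₂` with the same displacement is the
difference of their sums at the START minus the same difference TRANSLATED by `L e_κ` (the straight segments cancel, the
reversed far legs are the translated legs with a sign). [folklore] -/
theorem asum_contour_sub (A : Site d → Fin d → 𝔸) (p : Site d) (κ : Fin d) (L : ℕ) {w₁ w₂ : List (Letter d)}
    (h : disp w₁ = disp w₂) :
    asum A p (w₁ ++ seg κ L ++ revWord w₁ ++ seg κ (-(L : ℤ))) - asum A p (w₂ ++ seg κ L ++ revWord w₂ ++ seg κ (-(L : ℤ)))
      = (asum A p w₁ - asum A p w₂)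
        - (asum A (p + (L : ℤ) • e κ) w₁ - asum A (p + (L : ℤ) • e κ) w₂) := by
  have h₁ : asum A (p + (disp w₁ + (L : ℤ) • e κ)) (revWord w₁) = -asum A (p + (L : ℤ) • e κ) w₁ :=
    asum_revWord' A _ _ (by abel)
  have h₂ : asum A (p + (disp w₂ + (L : ℤ) • e κ)) (revWord w₂) = -asum A (p + (L : ℤ) • e κ) w₂ :=
    asum_revWord' A _ _ (by abel)
  simp only [asum_append, disp_append, disp_seg, disp_revWord]
  rw [h₁, h₂, h]
  abel

/-- The defect of one relabelled contour sum against the standard one, as ONE closed-loop circulation: the `σ`-ordered broken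
line followed by the reversed tree contour is a CLOSED loop (`disp = 0`), and `A(permWord σ v) − A(treeWord v)` is the
circulation of `A` around it. [folklore] -/
theorem asum_permWord_sub_treeWord (σ : Equiv.Perm (Fin d)) (A : Site d → Fin d → 𝔸) (p : Site d) (v : Site d) :
    asum A p (permWord σ v) - asum A p (treeWord v) = asum A p (permWord σ v ++ revWord (treeWord v)) ∧
      disp (permWord σ v ++ revWord (treeWord v)) = 0 := by
  refine ⟨?_, by rw [disp_append, disp_revWord, disp_permWord, disp_treeWord, add_neg_cancel]⟩
  rw [asum_append, disp_permWord, asum_revWord' A (x := p) _ _ (by rw [disp_treeWord]), sub_eq_add_neg]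

variable [NormedAlgebra ℂ 𝔸]

/-- **(42) OF THE RELABELLED FIELD, LINEARISED**: the first-order exponent `X̂` of the relabelled bond field at `(q, κ)` is the
`σ`-ORDERED first-order exponent of the field at `(r_σ q, σκ)` — the block is carried to the block, the contours to the
`σ`-ordered contours. [cite: Balaban1985Averaging, (42) p.23, (47)–(48) p.25] -/
theorem Xhat_permCfg_eq (L : ℕ) (σ : Equiv.Perm (Fin d)) (A : Site d → Fin d → 𝔸) (q : Site d) (κ : Fin d) :
    Xhat L (permCfg σ A) q κ = ∑ r : Fin d → Fin L, (((L : ℝ) ^ d)⁻¹) •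
      asum A (permSite σ q) (permWord σ (boxVec L r) ++ seg (σ κ) L ++ revWord (permWord σ (boxVec L r))
        ++ seg (σ κ) (-(L : ℤ))) := by
  unfold Xhat
  simp only [asum_permCfg, List.map_append, map_permLetter_gammaWord, map_seg, permSite_boxVec]
  exact Equiv.sum_comp (Equiv.arrowCongr σ (Equiv.refl (Fin L)))
    (fun r : Fin d → Fin L => (((L : ℝ) ^ d)⁻¹) •
      asum A (permSite σ q) (permWord σ (boxVec L r) ++ seg (σ κ) L ++ revWord (permWord σ (boxVec L r))
        ++ seg (σ κ) (-(L : ℤ))))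

/-- **★ THE EXACT DEFECT IDENTITY (any normed ring).**  The first-order exponent of (42) for the relabelled field minus the
first-order exponent of the field at the relabelled bond is the block mean of
`[D_v(q′) − D_v(q′ + L e_{σκ})]`, `D_v(p) = A(permWord σ v from p) − A(treeWord v from p)` (`q′ = r_σ q`): the STEP-`L`
DIFFERENCE in the bond direction of a block mean of CLOSED-LOOP CIRCULATIONS (`asum_permWord_sub_treeWord`) — a pure
lattice-derivative term. [folklore] -/
theorem Xhat_permCfg_sub (L : ℕ) (σ : Equiv.Perm (Fin d)) (A : Site d → Fin d → 𝔸) (q : Site d) (κ : Fin d) :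
    Xhat L (permCfg σ A) q κ - Xhat L A (permSite σ q) (σ κ)
      = ∑ r : Fin d → Fin L, (((L : ℝ) ^ d)⁻¹) •
          ((asum A (permSite σ q) (permWord σ (boxVec L r)) - asum A (permSite σ q) (treeWord (boxVec L r)))
            - (asum A (permSite σ q + (L : ℤ) • e (σ κ)) (permWord σ (boxVec L r))
                - asum A (permSite σ q + (L : ℤ) • e (σ κ)) (treeWord (boxVec L r)))) := by
  rw [Xhat_permCfg_eq]
  unfold Xhat
  rw [← Finset.sum_sub_distrib]
  refine Finset.sum_congr rfl fun r _ => ?_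
  rw [← smul_sub, gammaWord, asum_contour_sub A _ _ L (by rw [disp_permWord, disp_treeWord])]

/-- The defect identity with each term displayed as a CLOSED-LOOP circulation (`loop_v = permWord σ v ++ revWord (treeWord v)`,
`disp loop_v = 0`): `X̂[r_σA](q,κ) − X̂[A](q′,σκ) = Σ_r L^{−d} • (A(loop_{v_r} from q′) − A(loop_{v_r} from q′ + L e_{σκ}))`. [folklore] -/
theorem Xhat_permCfg_sub_eq_loops (L : ℕ) (σ : Equiv.Perm (Fin d)) (A : Site d → Fin d → 𝔸) (q : Site d) (κ : Fin d) :
    Xhat L (permCfg σ A) q κ - Xhat L A (permSite σ q) (σ κ)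
      = ∑ r : Fin d → Fin L, (((L : ℝ) ^ d)⁻¹) •
          (asum A (permSite σ q) (permWord σ (boxVec L r) ++ revWord (treeWord (boxVec L r)))
            - asum A (permSite σ q + (L : ℤ) • e (σ κ)) (permWord σ (boxVec L r) ++ revWord (treeWord (boxVec L r)))) := by
  rw [Xhat_permCfg_sub]
  refine Finset.sum_congr rfl fun r _ => ?_
  rw [(asum_permWord_sub_treeWord σ A _ _).1, (asum_permWord_sub_treeWord σ A _ _).1]

/-- The same identity for the linear contour average `T_c = X̂_c + A(Γ_c)` (the straight segment is relabelled to the straight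
segment, so it drops out of the defect). [folklore] -/
theorem Tside_permCfg_sub (L : ℕ) (hL : 1 ≤ L) (σ : Equiv.Perm (Fin d)) (A : Site d → Fin d → 𝔸) (q : Site d)
    (κ : Fin d) :
    Tside L (permCfg σ A) q κ - Tside L A (permSite σ q) (σ κ)
      = Xhat L (permCfg σ A) q κ - Xhat L A (permSite σ q) (σ κ) := by
  rw [Xhat_eq L hL, Xhat_eq L hL, asum_seg_permCfg]
  abel

/-- **NO DEFECT WHEN THE LOOP CIRCULATIONS ARE `L e_{σκ}`-PERIODIC** (e.g. a bond field periodic with period `L` in the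
direction `σκ`): then `X̂` of the relabelled field IS `X̂` of the field at the relabelled bond. [folklore] -/
theorem Xhat_permCfg_eq_of_periodic (L : ℕ) (σ : Equiv.Perm (Fin d)) (A : Site d → Fin d → 𝔸) (q : Site d)
    (κ : Fin d)
    (hper : ∀ v : Site d, asum A (permSite σ q + (L : ℤ) • e (σ κ)) (permWord σ v ++ revWord (treeWord v))
      = asum A (permSite σ q) (permWord σ v ++ revWord (treeWord v))) :
    Xhat L (permCfg σ A) q κ = Xhat L A (permSite σ q) (σ κ) := by
  rw [← sub_eq_zero, Xhat_permCfg_sub]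
  refine Finset.sum_eq_zero fun r _ => ?_
  rw [(asum_permWord_sub_treeWord σ A _ _).1, (asum_permWord_sub_treeWord σ A _ _).1, hper, sub_self, smul_zero]

/-! ## §3 Constant flux: no defect.  Lipschitz flux: a defect of order `L³ δ` -/

/-- **★ CONSTANT FLUX ⇒ (42) IS RELABELLING-EQUIVARIANT AT FIRST ORDER.**  If the plaquette circulations of `A` in the planes
`(m, σκ)` do not depend on the base point (`A(∂p)_p(plaqWord m (σκ)) = f m`), then
`Xhat L (permCfg σ A) q κ = Xhat L A (r_σ q) (σκ)`: both sides are the tree's constant-flux value `(L(L−1)/2) • Σ_m f_m`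
(`BlockAverageLoopFlux.Xhat_of_const_flux`), the relabelled side after the reindexing `m ↦ σm`. [folklore] -/
theorem Xhat_permCfg_of_const_flux (L : ℕ) (hL : 1 ≤ L) (σ : Equiv.Perm (Fin d)) (A : Site d → Fin d → 𝔸)
    (q : Site d) (κ : Fin d) (f : Fin d → 𝔸) (hf : ∀ (p : Site d) (m : Fin d), asum A p (plaqWord m (σ κ)) = f m) :
    Xhat L (permCfg σ A) q κ = Xhat L A (permSite σ q) (σ κ) := by
  have h1 : Xhat L (permCfg σ A) q κ = (((L : ℝ) * (L - 1)) / 2) • ∑ m : Fin d, f (σ m) :=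
    Xhat_of_const_flux L hL (permCfg σ A) q κ (fun m => f (σ m)) fun p m => by rw [asum_plaqWord_permCfg, hf]
  rw [h1, Xhat_of_const_flux L hL A (permSite σ q) (σ κ) f hf, Equiv.sum_comp σ f]

/-- The same for the linear contour average `T_c`. [folklore] -/
theorem Tside_permCfg_of_const_flux (L : ℕ) (hL : 1 ≤ L) (σ : Equiv.Perm (Fin d)) (A : Site d → Fin d → 𝔸)
    (q : Site d) (κ : Fin d) (f : Fin d → 𝔸) (hf : ∀ (p : Site d) (m : Fin d), asum A p (plaqWord m (σ κ)) = f m) :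
    Tside L (permCfg σ A) q κ = Tside L A (permSite σ q) (σ κ) := by
  rw [← sub_eq_zero, Tside_permCfg_sub L hL, Xhat_permCfg_of_const_flux L hL σ A q κ f hf, sub_self]

/-- **★ LIPSCHITZ FLUX ⇒ A DEFECT OF ORDER `L³δ`.**  If the plaquette circulations of `A` in the planes `(m, σκ)` are
`δ`-Lipschitz in the base point (in `|·|₁`, within distance `(d+2)L` of `q′ = r_σ q`), then
`‖Xhat L (permCfg σ A) q κ − Xhat L A q′ (σκ)‖ ≤ d(d+2)·L³·δ`: both sides are within `(d(d+2)/2)L³δ` of the common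
constant-flux value at `q′` (`BlockAverageLoopFlux.norm_Xhat_sub_const_flux_le`; `|r_σ p − q′|₁ = |p − q|₁`). [folklore] -/
theorem norm_Xhat_permCfg_sub_le (L : ℕ) (hL : 1 ≤ L) (σ : Equiv.Perm (Fin d)) (A : Site d → Fin d → 𝔸)
    (q : Site d) (κ : Fin d) {δ : ℝ} (hδ0 : 0 ≤ δ)
    (hδ : ∀ (p : Site d) (m : Fin d), l1 (p - permSite σ q) ≤ (d + 2) * L →
      ‖asum A p (plaqWord m (σ κ)) - asum A (permSite σ q) (plaqWord m (σ κ))‖ ≤ δ * l1 (p - permSite σ q)) :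
    ‖Xhat L (permCfg σ A) q κ - Xhat L A (permSite σ q) (σ κ)‖ ≤ d * (d + 2) * (L : ℝ) ^ 3 * δ := by
  set M : 𝔸 := (((L : ℝ) * (L - 1)) / 2) • ∑ m : Fin d, asum A (permSite σ q) (plaqWord m (σ κ)) with hM
  have h2 : ‖Xhat L A (permSite σ q) (σ κ) - M‖ ≤ d * (d + 2) / 2 * (L : ℝ) ^ 3 * δ :=
    norm_Xhat_sub_const_flux_le L hL A (permSite σ q) (σ κ) hδ0 hδ
  have hM' : M = (((L : ℝ) * (L - 1)) / 2) • ∑ m : Fin d, asum (permCfg σ A) q (plaqWord m κ) := by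
    rw [hM]
    congr 1
    simp only [asum_plaqWord_permCfg]
    exact (Equiv.sum_comp σ (fun m => asum A (permSite σ q) (plaqWord m (σ κ)))).symm
  have h1 : ‖Xhat L (permCfg σ A) q κ - M‖ ≤ d * (d + 2) / 2 * (L : ℝ) ^ 3 * δ := by
    rw [hM']
    refine norm_Xhat_sub_const_flux_le L hL (permCfg σ A) q κ hδ0 fun p m hp => ?_
    rw [asum_plaqWord_permCfg, asum_plaqWord_permCfg]
    have hl : l1 (permSite σ p - permSite σ q) = l1 (p - q) := by rw [← permSite_sub, l1_permSite]
    have hp' : l1 (permSite σ p - permSite σ q) ≤ (d + 2) * L := by rw [hl]; exact hp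
    have h := hδ (permSite σ p) (σ m) hp'
    rwa [hl] at h
  calc ‖Xhat L (permCfg σ A) q κ - Xhat L A (permSite σ q) (σ κ)‖
      = ‖(Xhat L (permCfg σ A) q κ - M) - (Xhat L A (permSite σ q) (σ κ) - M)‖ := by rw [sub_sub_sub_cancel_right]
    _ ≤ ‖Xhat L (permCfg σ A) q κ - M‖ + ‖Xhat L A (permSite σ q) (σ κ) - M‖ := norm_sub_le _ _
    _ ≤ d * (d + 2) / 2 * (L : ℝ) ^ 3 * δ + d * (d + 2) / 2 * (L : ℝ) ^ 3 * δ := add_le_add h1 h2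
    _ = d * (d + 2) * (L : ℝ) ^ 3 * δ := by ring

/-- The same bound for the linear contour average `T_c`. [folklore] -/
theorem norm_Tside_permCfg_sub_le (L : ℕ) (hL : 1 ≤ L) (σ : Equiv.Perm (Fin d)) (A : Site d → Fin d → 𝔸)
    (q : Site d) (κ : Fin d) {δ : ℝ} (hδ0 : 0 ≤ δ)
    (hδ : ∀ (p : Site d) (m : Fin d), l1 (p - permSite σ q) ≤ (d + 2) * L →
      ‖asum A p (plaqWord m (σ κ)) - asum A (permSite σ q) (plaqWord m (σ κ))‖ ≤ δ * l1 (p - permSite σ q)) :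
    ‖Tside L (permCfg σ A) q κ - Tside L A (permSite σ q) (σ κ)‖ ≤ d * (d + 2) * (L : ℝ) ^ 3 * δ := by
  rw [Tside_permCfg_sub L hL]
  exact norm_Xhat_permCfg_sub_le L hL σ A q κ hδ0 hδ

omit [NormedAlgebra ℂ 𝔸] in
/-- **LOOP SUMS FROM A FLUX BOUND.**  If the plaquette circulations of `A` in the planes `(m, κ)` are bounded by `φ` (all base
points), every loop sum of (42) at a `κ`-bond is bounded by `d·L²·φ`: by the tree's loop-flux formula
(`BlockAverageLoopFlux.asum_loop_eq_sum_plaq`) the loop `Γ_{c,x} ∪ (−Γ_c)` encloses `Σ_m r_m·L ≤ d(L−1)L` plaquettes of those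
planes.  (So the ball of the logarithm is reached by a SMALL FLUX — the bond field itself may grow linearly, as a constant-curvature
field does.) [folklore] -/
theorem norm_loop_le_of_flux (L : ℕ) (A : Site d → Fin d → 𝔸) (q : Site d) (κ : Fin d) {φ : ℝ} (hφ0 : 0 ≤ φ)
    (hφ : ∀ (p : Site d) (m : Fin d), ‖asum A p (plaqWord m κ)‖ ≤ φ) (r : Fin d → Fin L) :
    ‖asum A q (gammaWord L κ (boxVec L r) ++ seg κ (-(L : ℤ)))‖ ≤ d * (L : ℝ) ^ 2 * φ := by
  rw [show boxVec L r = fun j => ((fun j => (r j : ℕ)) j : ℤ) from rfl,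
    Summit.QuantumFields.BalabanUV.T4Continuum.BlockAverageLoopFlux.asum_loop_eq_sum_plaq]
  calc ‖∑ m : Fin d, ∑ i ∈ Finset.range (r m : ℕ), ∑ j ∈ Finset.range L,
          asum A (q + Summit.QuantumFields.BalabanUV.T4Continuum.BlockAverageLoopFlux.upper ((m : ℕ) + 1)
            (fun j => ((r j : ℕ) : ℤ)) + (i : ℤ) • e m + (j : ℤ) • e κ) (plaqWord m κ)‖
      ≤ ∑ m : Fin d, ∑ i ∈ Finset.range (r m : ℕ), ∑ j ∈ Finset.range L,
          ‖asum A (q + Summit.QuantumFields.BalabanUV.T4Continuum.BlockAverageLoopFlux.upper ((m : ℕ) + 1)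
            (fun j => ((r j : ℕ) : ℤ)) + (i : ℤ) • e m + (j : ℤ) • e κ) (plaqWord m κ)‖ := by
        refine (norm_sum_le _ _).trans (Finset.sum_le_sum fun m _ => ?_)
        exact (norm_sum_le _ _).trans (Finset.sum_le_sum fun i _ => norm_sum_le _ _)
    _ ≤ ∑ m : Fin d, ∑ _i ∈ Finset.range (r m : ℕ), ∑ _j ∈ Finset.range L, φ :=
        Finset.sum_le_sum fun m _ => Finset.sum_le_sum fun i _ => Finset.sum_le_sum fun j _ => hφ _ _
    _ = ∑ m : Fin d, ((r m : ℕ) : ℝ) * (L * φ) := by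
        refine Finset.sum_congr rfl fun m _ => ?_
        rw [Finset.sum_const, Finset.sum_const, Finset.card_range, Finset.card_range, nsmul_eq_mul, nsmul_eq_mul]
    _ ≤ ∑ _m : Fin d, (L : ℝ) * (L * φ) :=
        Finset.sum_le_sum fun m _ => mul_le_mul_of_nonneg_right (by exact_mod_cast (r m).isLt.le) (by positivity)
    _ = d * (L : ℝ) ^ 2 * φ := by
        rw [Finset.sum_const, Finset.card_univ, Fintype.card_fin, nsmul_eq_mul]; ring

omit [NormedAlgebra ℂ 𝔸] in
/-- Hence a flux bound `d·L²·φ < log 2` puts every loop variable of (42) at a `κ`-bond inside the ball of the logarithm. [folklore] -/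
theorem loop_small_of_flux (L : ℕ) (A : Site d → Fin d → 𝔸) (q : Site d) (κ : Fin d) {φ : ℝ} (hφ0 : 0 ≤ φ)
    (hφ : ∀ (p : Site d) (m : Fin d), ‖asum A p (plaqWord m κ)‖ ≤ φ) (hφL : d * (L : ℝ) ^ 2 * φ < Real.log 2)
    (r : Fin d → Fin L) : ‖asum A q (gammaWord L κ (boxVec L r) ++ seg κ (-(L : ℤ)))‖ < Real.log 2 :=
  (norm_loop_le_of_flux L A q κ hφ0 hφ r).trans_lt hφL

omit [NormedAlgebra ℂ 𝔸] in
/-- The flux bound is inherited by the relabelled field (its `(m, κ)`-circulations are the `(σm, σκ)`-circulations of the field). [folklore] -/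
theorem flux_bound_permCfg (σ : Equiv.Perm (Fin d)) (A : Site d → Fin d → 𝔸) (κ : Fin d) {φ : ℝ}
    (hφ : ∀ (p : Site d) (m : Fin d), ‖asum A p (plaqWord m (σ κ))‖ ≤ φ) (p : Site d) (m : Fin d) :
    ‖asum (permCfg σ A) p (plaqWord m κ)‖ ≤ φ := by
  rw [asum_plaqWord_permCfg]; exact hφ _ _

end Linear

/-! ## §4 Non-vacuity of the constant-flux hypothesis: constant-flux bond fields exist (lattice constant curvature) -/

section ConstFlux

variable {𝔸 : Type*} [NormedRing 𝔸]

/-- One difference quotient of the «linear potential» `A(x, κ) = Σ_{ν<κ} x_ν • f ν κ`: `A(p + e_μ, κ) − A(p, κ) = [μ < κ]·f μ κ`. [folklore] -/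
theorem linPot_diff (f : Fin d → Fin d → 𝔸) (p : Site d) (μ κ : Fin d) :
    (∑ ν : Fin d, if ν < κ then ((p + e μ) ν) • f ν κ else 0) - (∑ ν : Fin d, if ν < κ then (p ν) • f ν κ else 0)
      = if μ < κ then f μ κ else 0 := by
  rw [← Finset.sum_sub_distrib]
  have hterm : ∀ ν : Fin d, ((if ν < κ then ((p + e μ) ν) • f ν κ else 0) - if ν < κ then (p ν) • f ν κ else 0)
      = if ν = μ then (if μ < κ then f μ κ else 0) else 0 := by
    intro ν
    by_cases hν : ν = μ
    · subst hν
      simp only [Pi.add_apply, e_apply, if_true]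
      split_ifs
      · rw [add_smul, one_smul]; abel
      · rw [sub_self]
    · simp only [Pi.add_apply, e_apply, hν, if_false, add_zero, sub_self]
  rw [Finset.sum_congr rfl fun ν _ => hterm ν, Finset.sum_ite_eq' Finset.univ μ, if_pos (Finset.mem_univ μ)]

/-- **CONSTANT-FLUX BOND FIELDS EXIST** for every prescribed antisymmetric family `f` of plaquette values with zero diagonal: the
linear potential `A(x, κ) = Σ_{ν<κ} x_ν • f ν κ` (a lattice constant-curvature field; it grows linearly, its circulations do not
depend on the base point).  So the hypotheses of `bavg_permCfg_expUnit_of_const_flux` are inhabited by NON-FLAT fields (any `f` with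
`d·L²·‖f m k‖ < log 2`), not only by pure gauges. [folklore] -/
theorem exists_const_flux (f : Fin d → Fin d → 𝔸) (hdiag : ∀ m : Fin d, f m m = 0)
    (hanti : ∀ m k : Fin d, m ≠ k → f k m = -f m k) :
    ∃ A : Site d → Fin d → 𝔸, ∀ (p : Site d) (m k : Fin d), asum A p (plaqWord m k) = f m k := by
  refine ⟨fun x κ => ∑ ν : Fin d, if ν < κ then (x ν) • f ν κ else 0, fun p m k => ?_⟩
  rw [asum_plaqWord,
    show (∑ ν : Fin d, if ν < m then (p ν) • f ν m else 0) + (∑ ν : Fin d, if ν < k then ((p + e m) ν) • f ν k else 0)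
        - (∑ ν : Fin d, if ν < m then ((p + e k) ν) • f ν m else 0) - (∑ ν : Fin d, if ν < k then (p ν) • f ν k else 0)
      = ((∑ ν : Fin d, if ν < k then ((p + e m) ν) • f ν k else 0) - (∑ ν : Fin d, if ν < k then (p ν) • f ν k else 0))
        - ((∑ ν : Fin d, if ν < m then ((p + e k) ν) • f ν m else 0) - (∑ ν : Fin d, if ν < m then (p ν) • f ν m else 0)) by
      abel,
    linPot_diff, linPot_diff]
  rcases lt_trichotomy m k with h | h | h
  · rw [if_pos h, if_neg (lt_asymm h), sub_zero]
  · subst h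
    rw [if_neg (lt_irrefl _), sub_zero, hdiag]
  · rw [if_neg (lt_asymm h), if_pos h, zero_sub, hanti k m (ne_of_lt h)]

end ConstFlux


end

end Summit.QuantumFields.YangMills.BalabanUVNodes.N16Eq42PermutationDefect
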